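import Literature.Geometry.Lorentzian.TeukolskyWhitingKernel
import HarnessLib

/-!
# Whiting's integral transformation off the real axis: definition, absolute convergence and
# differentiation under the integral sign (Teixeira da Costa 2020, §3.2, `y ω > 0`)

Fifth file of the proof programme for the named fact
`Literature.Geometry.Lorentzian.Kerr.Costa2019_realAxisModeStability` (R. Teixeira da Costa,
Commun. Math. Phys. 378 (2020) 705–781 = arXiv:1910.02854 [Costa2019], Thm. 4.1). For a
function `Φ` on `(r₊, ∞)` (in the application `Φ = (r−r₋)^η (r−r₊)^ξ e^{γr} R = w g`, TdC
(def-g-tilde-sub), cf. `Costa2019.heunMeasure_mul_heunWeight`) the transform is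
`g̃(z) = ∫_{r₊}^∞ e^{A(z−r₋)(r−r₋)} Φ(r) dr`, `A = 2iω/(r₊ − r₋)` (`Costa2019.whitingTransform`).
Off the real axis on the side `y ω > 0` (`z = x + iy`) the kernel decays exponentially in `r`,
`|e^{A(z−r₋)(r−r₋)}| = e^{−(2ωy/(r₊−r₋))(r−r₋)}` (`norm_whitingKernel`), independently of `x`;
hence for `Φ` continuous and polynomially bounded on `(r₊, ∞)` the transform and its formal
`x`-derivatives (extra factors `(A(r−r₋))ʲ`) converge absolutely (`integrableOn_whitingKernel_mul`)
and `x ↦ g̃(x+iy)` may be differentiated twice under the integral sign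
(`hasDerivAt_whitingTransform`, `hasDerivAt_whitingTransform_deriv`) — TdC, proof of Lemma 3.12:
"If either `Im ω > 0` … or `yω > 0`, the integral is absolutely convergent and we can thus
differentiate under the integral". Everything is proved; one definition with body, no named facts.

## References
* R. Teixeira da Costa, CMP 378 (2020) 705–781, arXiv:1910.02854, §3.2.1–3.2.2, Lemma 3.12.
  [Costa2019]
-/

noncomputable section

open Complex Set MeasureTheory Filter Topology

namespace Literature.Geometry.Lorentzian.Kerr

namespace Costa2019

/-! ### The transform -/

/-- **Whiting's integral transformation** of a function `Φ` on `(r₊, ∞)`: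
`g̃(z) = ∫_{r₊}^∞ e^{A(z−r₋)(r−r₋)} Φ(r) dr` (Bochner integral over `Ioi r₊`; it is the intended
object where the integrand is integrable, e.g. for `y ω > 0` and `Φ` polynomially bounded, and
`0` by convention otherwise). [cite: Costa2019, §3.2 (subextremal-transformation), (def-g-tilde-sub)] -/
def whitingTransform (M a ω : ℝ) (Φ : ℝ → ℂ) (z : ℂ) : ℂ :=
  ∫ r in Ioi (rPlus M a), whitingKernel M a ω z r * Φ r

/-! ### The kernel: size and continuity -/

/-- `|e^{A(x+iy−r₋)(r−r₋)}| = e^{−(2ωy/(r₊−r₋))(r−r₋)}` (independent of `x`).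
[cite: Costa2019, §3.2.1] -/
theorem norm_whitingKernel {M a : ℝ} (ha : |a| < M) (ω x y r : ℝ) :
    ‖whitingKernel M a ω ((x : ℂ) + I * y) r‖ =
      Real.exp (-(2 * ω * y / (rPlus M a - rMinus M a)) * (r - rMinus M a)) := by
  have hd : rPlus M a - rMinus M a ≠ 0 := (sub_pos.2 (IsSubextremal.rMinus_lt_rPlus ha)).ne'
  have hdc : ((rPlus M a - rMinus M a : ℝ) : ℂ) ≠ 0 := by exact_mod_cast hd
  unfold whitingKernel whitingA
  rw [Complex.norm_exp]
  congr 1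
  have h : 2 * I * ω / ((rPlus M a - rMinus M a : ℝ) : ℂ) * (((x : ℂ) + I * y) - rMinus M a) *
      ((r - rMinus M a : ℝ) : ℂ) =
      ((-(2 * ω * y / (rPlus M a - rMinus M a)) * (r - rMinus M a) : ℝ) : ℂ) +
        (((2 * ω * (x - rMinus M a) / (rPlus M a - rMinus M a)) * (r - rMinus M a) : ℝ) : ℂ) *
          I := by
    push_cast
    field_simp
    ring_nf
    rw [Complex.I_sq]
    ring
  rw [h]
  simp only [Complex.add_re, Complex.mul_re, Complex.ofReal_re, Complex.ofReal_im, Complex.I_re,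
    Complex.I_im]
  ring

/-- For `y ω ≥ 0` the kernel has modulus at most `1` on `[r₋, ∞)`. [cite: Costa2019, §3.2.1] -/
theorem norm_whitingKernel_le_one {M a : ℝ} (ha : |a| < M) {ω y : ℝ} (hyω : 0 ≤ ω * y) (x : ℝ)
    {r : ℝ} (hr : rMinus M a ≤ r) :
    ‖whitingKernel M a ω ((x : ℂ) + I * y) r‖ ≤ 1 := by
  rw [norm_whitingKernel ha]
  refine Real.exp_le_one_iff.2 ?_
  have hd : 0 < rPlus M a - rMinus M a := sub_pos.2 (IsSubextremal.rMinus_lt_rPlus ha)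
  have h1 : 0 ≤ 2 * ω * y / (rPlus M a - rMinus M a) := by
    have : 0 ≤ 2 * ω * y := by nlinarith
    positivity
  nlinarith [mul_nonneg h1 (sub_nonneg.2 hr)]

/-- The kernel is continuous in `r`. [folklore] -/
theorem continuous_whitingKernel_r (M a ω : ℝ) (z : ℂ) :
    Continuous fun r : ℝ => whitingKernel M a ω z r := by
  unfold whitingKernel
  exact Complex.continuous_exp.comp (continuous_const.mul
    (Complex.continuous_ofReal.comp (continuous_id.sub continuous_const)))

/-! ### Absolute convergence for `y ω > 0` -/

/-- **Domination of the integrand off the real axis.** For `y ω > 0`, `r > r₊` (`> 0`) and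
`‖Φ(r)‖ ≤ C(1+r)ᵏ`:
`‖e^{A(z−r₋)(r−r₋)} (A(r−r₋))ʲ Φ(r)‖ ≤ (‖A‖(1+|r₋|))ʲ C · e^{−(2ωy/(r₊−r₋))(r−r₋)} (1+r)^{j+k}`.
[cite: Costa2019, §3.2.1] -/
theorem norm_whitingKernel_mul_le {M a : ℝ} (hM : 0 < M) (ha : |a| < M) (ω x y : ℝ) (j : ℕ)
    {Φ : ℝ → ℂ} {C : ℝ} {k : ℕ} {r : ℝ} (hr : rPlus M a < r) (hΦ : ‖Φ r‖ ≤ C * (1 + r) ^ k) :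
    ‖whitingKernel M a ω ((x : ℂ) + I * y) r *
        (whitingA M a ω * ((r - rMinus M a : ℝ) : ℂ)) ^ j * Φ r‖ ≤
      (‖whitingA M a ω‖ * (1 + |rMinus M a|)) ^ j * C *
        (Real.exp (-(2 * ω * y / (rPlus M a - rMinus M a)) * (r - rMinus M a)) *
          (1 + r) ^ (j + k)) := by
  have hr0 : 0 < r := (rPlus_pos hM a).trans hr
  have hq : rMinus M a ≤ r := (rMinus_le_rPlus M a).trans hr.le
  have hfac : |r - rMinus M a| ≤ (1 + |rMinus M a|) * (1 + r) := by
    rw [abs_of_nonneg (sub_nonneg.2 hq)]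
    nlinarith [abs_nonneg (rMinus M a), neg_abs_le (rMinus M a), le_abs_self (rMinus M a)]
  rw [norm_mul, norm_mul, norm_pow, norm_mul, Complex.norm_real, Real.norm_eq_abs,
    norm_whitingKernel ha]
  calc Real.exp (-(2 * ω * y / (rPlus M a - rMinus M a)) * (r - rMinus M a)) *
        (‖whitingA M a ω‖ * |r - rMinus M a|) ^ j * ‖Φ r‖ ≤
      Real.exp (-(2 * ω * y / (rPlus M a - rMinus M a)) * (r - rMinus M a)) *
        (‖whitingA M a ω‖ * ((1 + |rMinus M a|) * (1 + r))) ^ j * (C * (1 + r) ^ k) := by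
        gcongr
    _ = (‖whitingA M a ω‖ * (1 + |rMinus M a|)) ^ j * C *
        (Real.exp (-(2 * ω * y / (rPlus M a - rMinus M a)) * (r - rMinus M a)) *
          (1 + r) ^ (j + k)) := by
        have hpow : (‖whitingA M a ω‖ * ((1 + |rMinus M a|) * (1 + r))) ^ j =
            (‖whitingA M a ω‖ * (1 + |rMinus M a|)) ^ j * (1 + r) ^ j := by
          rw [← mul_pow]; ring
        rw [hpow, pow_add]; ring

/-- **Absolute convergence off the real axis** (TdC §3.2.1–3.2.2): for `y ω > 0` and `Φ`
continuous on `(r₊, ∞)` with `‖Φ(r)‖ ≤ C(1+r)ᵏ` there, the integrand of the transform times any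
power `(A(r−r₋))ʲ` (the symbol of `∂ₓʲ` on the kernel) is integrable on `(r₊, ∞)`.
[cite: Costa2019, Lemma 3.12 (proof, first sentence)] -/
theorem integrableOn_whitingKernel_mul {M a : ℝ} (hM : 0 < M) (ha : |a| < M) {ω y : ℝ}
    (hyω : 0 < ω * y) (x : ℝ) (j : ℕ) {Φ : ℝ → ℂ} {C : ℝ} {k : ℕ}
    (hΦc : ContinuousOn Φ (Ioi (rPlus M a)))
    (hΦb : ∀ r, rPlus M a < r → ‖Φ r‖ ≤ C * (1 + r) ^ k) :
    IntegrableOn (fun r => whitingKernel M a ω ((x : ℂ) + I * y) r *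
      (whitingA M a ω * ((r - rMinus M a : ℝ) : ℂ)) ^ j * Φ r) (Ioi (rPlus M a)) := by
  have hd : 0 < rPlus M a - rMinus M a := sub_pos.2 (IsSubextremal.rMinus_lt_rPlus ha)
  have hc : 0 < 2 * ω * y / (rPlus M a - rMinus M a) := by
    have : 0 < 2 * ω * y := by nlinarith
    positivity
  refine integrableOn_Ioi_of_norm_le_exp_mul_pow hc (rMinus M a) ?_ fun r hr =>
    norm_whitingKernel_mul_le hM ha ω x y j hr (hΦb r hr)
  refine ContinuousOn.mul (ContinuousOn.mul (continuous_whitingKernel_r M a ω _).continuousOn ?_)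
    hΦc
  exact (continuous_const.mul (Complex.continuous_ofReal.comp
    (continuous_id.sub continuous_const))).pow j |>.continuousOn

/-! ### Differentiation under the integral sign in `x` (`y ω > 0`) -/

/-- **First `x`-derivative of the transform under the integral sign** (TdC, proof of
Lemma 3.12): for `y ω > 0` and `Φ` continuous and polynomially bounded on `(r₊, ∞)`,
`d/dx g̃(x + iy) = ∫_{r₊}^∞ A(r−r₋) e^{A(z−r₋)(r−r₋)} Φ(r) dr`.
[cite: Costa2019, Lemma 3.12 (proof)] -/
theorem hasDerivAt_whitingTransform {M a : ℝ} (hM : 0 < M) (ha : |a| < M) {ω y : ℝ}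
    (hyω : 0 < ω * y) {Φ : ℝ → ℂ} {C : ℝ} {k : ℕ}
    (hΦc : ContinuousOn Φ (Ioi (rPlus M a)))
    (hΦb : ∀ r, rPlus M a < r → ‖Φ r‖ ≤ C * (1 + r) ^ k) (x : ℝ) :
    HasDerivAt (fun x : ℝ => whitingTransform M a ω Φ ((x : ℂ) + I * y))
      (∫ r in Ioi (rPlus M a), whitingKernel M a ω ((x : ℂ) + I * y) r *
        (whitingA M a ω * ((r - rMinus M a : ℝ) : ℂ)) * Φ r) x := by
  have hd : 0 < rPlus M a - rMinus M a := sub_pos.2 (IsSubextremal.rMinus_lt_rPlus ha)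
  have hc : 0 < 2 * ω * y / (rPlus M a - rMinus M a) := by
    have : 0 < 2 * ω * y := by nlinarith
    positivity
  have hint := integrableOn_whitingKernel_mul hM ha hyω x 0 hΦc hΦb
  simp only [pow_zero, mul_one] at hint
  have h := hasDerivAt_setIntegral_mul (κ := fun x r => whitingKernel M a ω ((x : ℂ) + I * y) r)
    (κ' := fun x r => whitingKernel M a ω ((x : ℂ) + I * y) r *
      (whitingA M a ω * ((r - rMinus M a : ℝ) : ℂ)))
    (Φ := Φ) (x₀ := x) measurableSet_Ioi
    (bound := fun r => (‖whitingA M a ω‖ * (1 + |rMinus M a|)) ^ 1 * C *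
        (Real.exp (-(2 * ω * y / (rPlus M a - rMinus M a)) * (r - rMinus M a)) *
          (1 + r) ^ (1 + k)))
    (fun x => (continuous_whitingKernel_r M a ω _).continuousOn)
    ((continuous_whitingKernel_r M a ω _).mul (continuous_const.mul
      (Complex.continuous_ofReal.comp (continuous_id.sub continuous_const)))).continuousOn
    hΦc hint
    (fun r hr x' => by
      have h := norm_whitingKernel_mul_le hM ha ω x' y 1 hr (hΦb r hr)
      simpa only [pow_one] using h)
    (((integrableOn_exp_neg_mul_pow hc (rMinus M a) (1 + k) (rPlus M a)).const_mul _))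
    (fun r _ x' => hasDerivAt_whitingKernel_x M a ω y r x')
  exact h.2

/-- **Second `x`-derivative under the integral sign**: for `y ω > 0`,
`d/dx ∫ A(r−r₋) e^{A(z−r₋)(r−r₋)} Φ = ∫ (A(r−r₋))² e^{A(z−r₋)(r−r₋)} Φ`.
[cite: Costa2019, Lemma 3.12 (proof)] -/
theorem hasDerivAt_whitingTransform_deriv {M a : ℝ} (hM : 0 < M) (ha : |a| < M) {ω y : ℝ}
    (hyω : 0 < ω * y) {Φ : ℝ → ℂ} {C : ℝ} {k : ℕ}
    (hΦc : ContinuousOn Φ (Ioi (rPlus M a)))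
    (hΦb : ∀ r, rPlus M a < r → ‖Φ r‖ ≤ C * (1 + r) ^ k) (x : ℝ) :
    HasDerivAt (fun x : ℝ => ∫ r in Ioi (rPlus M a), whitingKernel M a ω ((x : ℂ) + I * y) r *
        (whitingA M a ω * ((r - rMinus M a : ℝ) : ℂ)) * Φ r)
      (∫ r in Ioi (rPlus M a), whitingKernel M a ω ((x : ℂ) + I * y) r *
        (whitingA M a ω * ((r - rMinus M a : ℝ) : ℂ)) ^ 2 * Φ r) x := by
  have hd : 0 < rPlus M a - rMinus M a := sub_pos.2 (IsSubextremal.rMinus_lt_rPlus ha)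
  have hc : 0 < 2 * ω * y / (rPlus M a - rMinus M a) := by
    have : 0 < 2 * ω * y := by nlinarith
    positivity
  have hint := integrableOn_whitingKernel_mul hM ha hyω x 1 hΦc hΦb
  simp only [pow_one] at hint
  have hcA : Continuous fun r : ℝ => whitingA M a ω * ((r - rMinus M a : ℝ) : ℂ) :=
    continuous_const.mul (Complex.continuous_ofReal.comp (continuous_id.sub continuous_const))
  have h := hasDerivAt_setIntegral_mul
    (κ := fun x r => whitingKernel M a ω ((x : ℂ) + I * y) r *
      (whitingA M a ω * ((r - rMinus M a : ℝ) : ℂ)))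
    (κ' := fun x r => whitingKernel M a ω ((x : ℂ) + I * y) r *
      (whitingA M a ω * ((r - rMinus M a : ℝ) : ℂ)) ^ 2)
    (Φ := Φ) (x₀ := x) measurableSet_Ioi
    (bound := fun r => (‖whitingA M a ω‖ * (1 + |rMinus M a|)) ^ 2 * C *
        (Real.exp (-(2 * ω * y / (rPlus M a - rMinus M a)) * (r - rMinus M a)) *
          (1 + r) ^ (2 + k)))
    (fun x => ((continuous_whitingKernel_r M a ω _).mul hcA).continuousOn)
    ((continuous_whitingKernel_r M a ω _).mul (hcA.pow 2)).continuousOn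
    hΦc hint
    (fun r hr x' => norm_whitingKernel_mul_le hM ha ω x' y 2 hr (hΦb r hr))
    (((integrableOn_exp_neg_mul_pow hc (rMinus M a) (2 + k) (rPlus M a)).const_mul _))
    (fun r _ x' => by
      have h1 := (hasDerivAt_whitingKernel_x M a ω y r x').mul_const
        (whitingA M a ω * ((r - rMinus M a : ℝ) : ℂ))
      exact h1.congr_deriv (by ring))
  exact h.2

end Costa2019

end Literature.Geometry.Lorentzian.Kerr

end
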